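import Literature.IUT.HodgeArakelov.CohomologyLimitConj
import Literature.IUT.HodgeArakelov.CohomologyAutFunctoriality

/-!
# Restricting the coefficient AMBIENT of continuous `H¹` and of its direct limit (generic bookkeeping)

Generic support piece (abc-iut cell, WAVE-5 seat abc-iut-w5-d169, holder sub-row «P34i-GENUINE-(P1)» of DAG node
IUTchII:Prop3.4(i), `plan/L6/SUBDAG-IUTchII-Prop-31-33-34.md`).  L2's continuous cohomology `ContH1 φ A H`
(abc-iut-L2-t1, `ContH1.lean`) has coefficients an abelian normal subgroup `A` of an AMBIENT group `G'` on which
`G` acts by conjugation through `φ : G → G'`; abc-iut-L6-t1's `cohomologySystemOfContH1 φ A H`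
(`CohomologySystemOfContH1.lean`) is its direct limit over finite-index open levels.  S. Mochizuki,
*Inter-universal Teichmüller theory II*, kurims manuscript (Dec. 2020), Prop. 1.4 p. 27 describes the coefficients as
"a certain subquotient `(l·Δ_Θ)(Π)` of `Π`" — INTRINSIC to `Π`; the cell's genuine instantiation
(`EtaleThetaDataOfSetting.lean`) reads them inside the larger ambient `(Π^tp_X)^Θ ⊋ φ(Π^tp_X̲̲)`.  To let
AUTOMORPHISMS OF `Π` ALONE act (abc-iut-L6-t1's `h1LimAut` needs a companion on the whole ambient), this file
shrinks the ambient to any subgroup `T ≤ G'` with `φ(G) ⊆ T ⊇ A`: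
* `ContH1Restrict.h1Equiv : ContH1 φ A H ≃* ContH1 (φ.codRestrict T hT) (A.subgroupOf T) H` (cocycles are
  literally the same functions, read in `A.subgroupOf T ≅ A`), natural in restriction (`h1Equiv_res`), in L2's
  conjugation action (`h1Equiv_conj`) and in abc-iut-L6-t1's automorphism-pair transport (`h1Equiv_autMap`, for
  any pair of companions `β` on `G'`, `βT` on `T` that agree on `T`);
* `ContH1Restrict.limEquiv : h1Lim φ A H J ≃+ h1Lim (φ.codRestrict T hT) (A.subgroupOf T) H J`, commuting with
  `h1Of`, `h1Res` (hence `toLim`), abc-iut-w4-d043's `h1LimConj` and abc-iut-L6-t1's `h1LimAut`.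
Transport of structure in group cohomology [cite: NeukirchSchmidtWingberg2008, I §5]; pure bookkeeping over
Mathlib + the landed files (no `Prop`-valued definition, no named fact; claim key of the ambient interface
`Mochizuki2012`, disputed; nothing of [IUTchII] is asserted; no side taken on [IUTchIII] Cor. 3.12).
-/

namespace Literature.IUT.HodgeArakelov

open Literature.AnabelianGeometry.EtaleTheta CohomologySystemOfContH1

universe u

noncomputable section

namespace ContH1Restrict

/-! ### 1. Coefficients read inside the smaller ambient -/

section Coeff

variable {G' : Type u} [Group G'] (A T : Subgroup G') (hAT : A ≤ T)

/-- An element of `A`, read in `A.subgroupOf T` (`A ≤ T`). [cite: NeukirchSchmidtWingberg2008, I §5] -/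
def toIn (a : A) : A.subgroupOf T :=
  ⟨⟨(a : G'), hAT a.2⟩, Subgroup.mem_subgroupOf.2 a.2⟩

/-- An element of `A.subgroupOf T`, read in `A`. [cite: NeukirchSchmidtWingberg2008, I §5] -/
def ofIn (a : A.subgroupOf T) : A :=
  ⟨((a : T) : G'), Subgroup.mem_subgroupOf.1 a.2⟩

/-- `toIn`, coerced to `G'`. [cite: NeukirchSchmidtWingberg2008, I §5] -/
@[simp] theorem coe_coe_toIn (a : A) : (((toIn A T hAT a : A.subgroupOf T) : T) : G') = a := rfl

/-- `ofIn`, coerced to `G'`. [cite: NeukirchSchmidtWingberg2008, I §5] -/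
@[simp] theorem coe_ofIn (a : A.subgroupOf T) : ((ofIn A T a : A) : G') = ((a : T) : G') := rfl

/-- `ofIn ∘ toIn = id`. [cite: NeukirchSchmidtWingberg2008, I §5] -/
@[simp] theorem ofIn_toIn (a : A) : ofIn A T (toIn A T hAT a) = a := rfl

/-- `toIn ∘ ofIn = id`. [cite: NeukirchSchmidtWingberg2008, I §5] -/
@[simp] theorem toIn_ofIn (a : A.subgroupOf T) : toIn A T hAT (ofIn A T a) = a := rfl

/-- `toIn` is multiplicative. [cite: NeukirchSchmidtWingberg2008, I §5] -/
theorem toIn_mul (a b : A) : toIn A T hAT (a * b) = toIn A T hAT a * toIn A T hAT b := rfl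

/-- `toIn 1 = 1`. [cite: NeukirchSchmidtWingberg2008, I §5] -/
@[simp] theorem toIn_one : toIn A T hAT 1 = 1 := rfl

/-- `toIn a⁻¹ = (toIn a)⁻¹`. [cite: NeukirchSchmidtWingberg2008, I §5] -/
theorem toIn_inv (a : A) : toIn A T hAT a⁻¹ = (toIn A T hAT a)⁻¹ := rfl

/-- `toIn` is continuous (all topologies are induced from `G'`). [cite: NeukirchSchmidtWingberg2008, I §5] -/
theorem continuous_toIn [TopologicalSpace G'] : Continuous (toIn A T hAT) :=
  Continuous.subtype_mk (Continuous.subtype_mk continuous_subtype_val _) _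

/-- `ofIn` is continuous. [cite: NeukirchSchmidtWingberg2008, I §5] -/
theorem continuous_ofIn [TopologicalSpace G'] : Continuous (ofIn A T) :=
  Continuous.subtype_mk (continuous_subtype_val.comp continuous_subtype_val) _

/-- Conjugation by `t ∈ T` on `A.subgroupOf T` is conjugation by `t` on `A`, read inside `T`.
[cite: NeukirchSchmidtWingberg2008, I §5] -/
theorem toIn_conjNormal [A.Normal] (g : G') (hg : g ∈ T) (a : A) :
    toIn A T hAT (MulAut.conjNormal g a) = MulAut.conjNormal (⟨g, hg⟩ : T) (toIn A T hAT a) := by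
  apply Subtype.ext; apply Subtype.ext
  simp [MulAut.conjNormal_apply, toIn]

end Coeff

/-! ### 2. Cocycles and `H¹` -/

section Cocycle

variable {G : Type u} {G' : Type u} [Group G] [TopologicalSpace G]
  [Group G'] [TopologicalSpace G'] [IsTopologicalGroup G']
  (φ : G →* G') (A : Subgroup G') [A.Normal] [IsMulCommutative A]
  (T : Subgroup G') (hT : ∀ g, φ g ∈ T) (hAT : A ≤ T)

omit [TopologicalSpace G] [TopologicalSpace G'] [IsTopologicalGroup G'] [A.Normal] [IsMulCommutative A] in
/-- The coefficient homomorphism corestricted to `T`, coerced back to `G'`. [cite: NeukirchSchmidtWingberg2008, I §5] -/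
@[simp] theorem coe_codRestrict_apply (g : G) : ((φ.codRestrict T hT g : T) : G') = φ g := rfl

variable (H : Subgroup G)

/-- A cocycle with values in `A`, read with values in `A.subgroupOf T`, is a cocycle for the corestricted
action. [cite: NeukirchSchmidtWingberg2008, I §5] -/
theorem toIn_comp_mem (f : H → A) (hf : f ∈ contCocycles φ A H) :
    (fun x => toIn A T hAT (f x)) ∈ contCocycles (φ.codRestrict T hT) (A.subgroupOf T) H := by
  refine ⟨(continuous_toIn A T hAT).comp hf.1, fun g h => ?_⟩
  change toIn A T hAT (f (g * h)) = toIn A T hAT (f g) * MulAut.conjNormal (φ.codRestrict T hT g) (toIn A T hAT (f h))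
  rw [hf.2 g h, toIn_mul]
  exact congrArg (toIn A T hAT (f g) * ·) (toIn_conjNormal A T hAT (φ g) (hT g) (f h))

/-- Conversely. [cite: NeukirchSchmidtWingberg2008, I §5] -/
theorem ofIn_comp_mem (f : H → A.subgroupOf T) (hf : f ∈ contCocycles (φ.codRestrict T hT) (A.subgroupOf T) H) :
    (fun x => ofIn A T (f x)) ∈ contCocycles φ A H := by
  refine ⟨(continuous_ofIn A T).comp hf.1, fun g h => ?_⟩
  apply Subtype.ext
  have key := congrArg (fun a : A.subgroupOf T => ((a : T) : G')) (hf.2 g h)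
  simpa [MulAut.conjNormal_apply] using key

/-- **Restriction of the ambient on cocycles**: `Z¹(H, A) → Z¹(H, A.subgroupOf T)` (same functions).
[cite: NeukirchSchmidtWingberg2008, I §5] -/
def shrinkCocycle : contCocycles φ A H →* contCocycles (φ.codRestrict T hT) (A.subgroupOf T) H where
  toFun f := ⟨fun x => toIn A T hAT (f.1 x), toIn_comp_mem φ A T hT hAT H f.1 f.2⟩
  map_one' := rfl
  map_mul' _ _ := rfl

/-- … and back. [cite: NeukirchSchmidtWingberg2008, I §5] -/
def unshrinkCocycle : contCocycles (φ.codRestrict T hT) (A.subgroupOf T) H →* contCocycles φ A H where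
  toFun f := ⟨fun x => ofIn A T (f.1 x), ofIn_comp_mem φ A T hT H f.1 f.2⟩
  map_one' := rfl
  map_mul' _ _ := rfl

/-- `shrinkCocycle`, evaluated and coerced. [cite: NeukirchSchmidtWingberg2008, I §5] -/
@[simp] theorem coe_shrinkCocycle_apply (f : contCocycles φ A H) (x : H) :
    ((((shrinkCocycle φ A T hT hAT H f).1 x : A.subgroupOf T) : T) : G') = (f.1 x : G') := rfl

/-- `unshrinkCocycle`, evaluated and coerced. [cite: NeukirchSchmidtWingberg2008, I §5] -/
@[simp] theorem coe_unshrinkCocycle_apply (f : contCocycles (φ.codRestrict T hT) (A.subgroupOf T) H) (x : H) :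
    (((unshrinkCocycle φ A T hT H f).1 x : A) : G') = (((f.1 x : A.subgroupOf T) : T) : G') := rfl

/-- `unshrinkCocycle ∘ shrinkCocycle = id`. [cite: NeukirchSchmidtWingberg2008, I §5] -/
@[simp] theorem unshrinkCocycle_shrinkCocycle (f : contCocycles φ A H) :
    unshrinkCocycle φ A T hT H (shrinkCocycle φ A T hT hAT H f) = f := rfl

/-- `shrinkCocycle ∘ unshrinkCocycle = id`. [cite: NeukirchSchmidtWingberg2008, I §5] -/
@[simp] theorem shrinkCocycle_unshrinkCocycle (f : contCocycles (φ.codRestrict T hT) (A.subgroupOf T) H) :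
    shrinkCocycle φ A T hT hAT H (unshrinkCocycle φ A T hT H f) = f := rfl

/-- **Restriction of the ambient on `H¹`**: `H¹(H, A) → H¹(H, A.subgroupOf T)` (coboundaries `∂a ↦ ∂(toIn a)`).
[cite: NeukirchSchmidtWingberg2008, I §5] -/
def h1Shrink : ContH1 φ A H →* ContH1 (φ.codRestrict T hT) (A.subgroupOf T) H :=
  QuotientGroup.map _ _ (shrinkCocycle φ A T hT hAT H) (by
    intro f hf
    obtain ⟨a, ha⟩ := (mem_contCoboundaries_iff _).mp (Subgroup.mem_subgroupOf.mp hf)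
    refine Subgroup.mem_subgroupOf.mpr ((mem_contCoboundaries_iff _).mpr ⟨toIn A T hAT a, ?_⟩)
    funext x
    change toIn A T hAT (f.1 x) = MulAut.conjNormal (φ.codRestrict T hT x) (toIn A T hAT a) * (toIn A T hAT a)⁻¹
    rw [ha, toIn_mul, toIn_inv, toIn_conjNormal A T hAT (φ x) (hT x)]
    rfl)

/-- … and back: `H¹(H, A.subgroupOf T) → H¹(H, A)`. [cite: NeukirchSchmidtWingberg2008, I §5] -/
def h1Unshrink : ContH1 (φ.codRestrict T hT) (A.subgroupOf T) H →* ContH1 φ A H :=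
  QuotientGroup.map _ _ (unshrinkCocycle φ A T hT H) (by
    intro f hf
    obtain ⟨a, ha⟩ := (mem_contCoboundaries_iff _).mp (Subgroup.mem_subgroupOf.mp hf)
    refine Subgroup.mem_subgroupOf.mpr ((mem_contCoboundaries_iff _).mpr ⟨ofIn A T a, ?_⟩)
    funext x
    apply Subtype.ext
    have hx := congrArg (fun b : A.subgroupOf T => ((b : T) : G')) (congrFun ha x)
    simpa [MulAut.conjNormal_apply] using hx)

/-- `h1Shrink` on classes. [cite: NeukirchSchmidtWingberg2008, I §5] -/
theorem h1Shrink_mk (f : contCocycles φ A H) :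
    h1Shrink φ A T hT hAT H (QuotientGroup.mk f) = QuotientGroup.mk (shrinkCocycle φ A T hT hAT H f) := rfl

/-- `h1Unshrink` on classes. [cite: NeukirchSchmidtWingberg2008, I §5] -/
theorem h1Unshrink_mk (f : contCocycles (φ.codRestrict T hT) (A.subgroupOf T) H) :
    h1Unshrink φ A T hT H (QuotientGroup.mk f) = QuotientGroup.mk (unshrinkCocycle φ A T hT H f) := rfl

/-- **`H¹(H, A) ≅ H¹(H, A.subgroupOf T)`**: continuous cohomology does not see the part of the ambient outside
`T ⊇ φ(G) ∪ A`. [cite: NeukirchSchmidtWingberg2008, I §5] -/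
def h1Equiv : ContH1 φ A H ≃* ContH1 (φ.codRestrict T hT) (A.subgroupOf T) H where
  toFun := h1Shrink φ A T hT hAT H
  invFun := h1Unshrink φ A T hT H
  left_inv x := by
    induction x using QuotientGroup.induction_on with
    | H f => rfl
  right_inv x := by
    induction x using QuotientGroup.induction_on with
    | H f => rfl
  map_mul' := map_mul _

/-- `h1Equiv` is `h1Shrink` as a function. [cite: NeukirchSchmidtWingberg2008, I §5] -/
@[simp] theorem h1Equiv_apply (x : ContH1 φ A H) : h1Equiv φ A T hT hAT H x = h1Shrink φ A T hT hAT H x := rfl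

/-- `h1Equiv.symm` is `h1Unshrink` as a function. [cite: NeukirchSchmidtWingberg2008, I §5] -/
@[simp] theorem h1Equiv_symm_apply (x : ContH1 (φ.codRestrict T hT) (A.subgroupOf T) H) :
    (h1Equiv φ A T hT hAT H).symm x = h1Unshrink φ A T hT H x := rfl

variable {H}

/-- NATURALITY in restriction: `h1Equiv ∘ res = res ∘ h1Equiv`. [cite: NeukirchSchmidtWingberg2008, I §5] -/
theorem h1Equiv_res {H₁ H₂ : Subgroup G} (h : H₁ ≤ H₂) (x : ContH1 φ A H₂) :
    h1Equiv φ A T hT hAT H₁ (ContH1.res φ A h x) =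
      ContH1.res (φ.codRestrict T hT) (A.subgroupOf T) h (h1Equiv φ A T hT hAT H₂ x) := by
  induction x using QuotientGroup.induction_on with
  | H f => rfl

/-- NATURALITY in L2's conjugation action (`H` normal): `h1Equiv ∘ conj σ = conj σ ∘ h1Equiv`.
[cite: NeukirchSchmidtWingberg2008, I §5] -/
theorem h1Equiv_conj [IsTopologicalGroup G] (H : Subgroup G) [H.Normal] (σ : G) (x : ContH1 φ A H) :
    h1Equiv φ A T hT hAT H (ContH1.conj φ A σ x) =
      ContH1.conj (φ.codRestrict T hT) (A.subgroupOf T) σ (h1Equiv φ A T hT hAT H x) := by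
  induction x using QuotientGroup.induction_on with
  | H f =>
    change QuotientGroup.mk (shrinkCocycle φ A T hT hAT H (ContH1.conjCocycle φ A σ f)) =
      QuotientGroup.mk (ContH1.conjCocycle (φ.codRestrict T hT) (A.subgroupOf T) σ (shrinkCocycle φ A T hT hAT H f))
    rfl

/-- NATURALITY in abc-iut-L6-t1's automorphism-pair transport: for companions `β` on `G'` and `βT` on `T` that
AGREE on `T`, `h1Equiv ∘ autMap (α, β) = autMap (α, βT) ∘ h1Equiv`. [cite: NeukirchSchmidtWingberg2008, I §5] -/
theorem h1Equiv_autMap (α : G ≃ₜ* G) (β : G' ≃ₜ* G') (βT : T ≃ₜ* T) (hββ : ∀ t : T, ((βT t : T) : G') = β t)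
    (hφ : ∀ g, β (φ g) = φ (α g)) (hφT : ∀ g, βT (φ.codRestrict T hT g) = φ.codRestrict T hT (α g))
    (hA : ∀ a : G', a ∈ A → β a ∈ A) (hA' : ∀ a : T, a ∈ A.subgroupOf T → βT a ∈ A.subgroupOf T)
    {H H' : Subgroup G} (hH : ∀ x, x ∈ H' → α.symm x ∈ H) (x : ContH1 φ A H) :
    h1Equiv φ A T hT hAT H' (ContH1Aut.autMap φ A α β hφ hA hH x) =
      ContH1Aut.autMap (φ.codRestrict T hT) (A.subgroupOf T) α βT hφT hA' hH (h1Equiv φ A T hT hAT H x) := by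
  induction x using QuotientGroup.induction_on with
  | H f =>
    change QuotientGroup.mk (shrinkCocycle φ A T hT hAT H' (ContH1Aut.autCocycle φ A α β hφ hA hH f)) =
      QuotientGroup.mk (ContH1Aut.autCocycle (φ.codRestrict T hT) (A.subgroupOf T) α βT hφT hA' hH
        (shrinkCocycle φ A T hT hAT H f))
    congr 1
    apply Subtype.ext; funext y; apply Subtype.ext; apply Subtype.ext
    rw [coe_shrinkCocycle_apply, ContH1Aut.coe_autCocycle_apply, ContH1Aut.coe_autCocycle_apply, hββ]
    rfl

end Cocycle

/-! ### 3. The direct limit -/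

section Limit

variable {P : TopGroup.{u}} {G' : Type u} [Group G'] [TopologicalSpace G'] [IsTopologicalGroup G']
  (φ : P →* G') (A : Subgroup G') [A.Normal] [IsMulCommutative A] (H : Subgroup P)
  (T : Subgroup G') (hT : ∀ g, φ g ∈ T) (hAT : A ≤ T)

/-- The member isomorphisms `H¹(H ⊓ K, A) ≅ H¹(H ⊓ K, A.subgroupOf T)` (additively written).
[cite: Mochizuki2012, Prop 1.4 p.27] -/
def gmodEquiv (J : Subgroup P) (i : Idx (P := P) J) :
    Gmod φ A H J i ≃+ Gmod (φ.codRestrict T hT) (A.subgroupOf T) H J i :=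
  MulEquiv.toAdditive (h1Equiv φ A T hT hAT (H ⊓ i.K))

/-- The member isomorphisms commute with the transition maps. [cite: Mochizuki2012, Prop 1.4 p.27] -/
theorem gmodEquiv_fmod (J : Subgroup P) {i j : Idx (P := P) J} (hij : i ≤ j) (x : Gmod φ A H J i) :
    gmodEquiv φ A H T hT hAT J j (fmod φ A H J i j hij x) =
      fmod (φ.codRestrict T hT) (A.subgroupOf T) H J i j hij (gmodEquiv φ A H T hT hAT J i x) :=
  congrArg Additive.ofMul (h1Equiv_res φ A T hT hAT _ (Additive.toMul x))

/-- … and so do their inverses. [cite: Mochizuki2012, Prop 1.4 p.27] -/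
theorem gmodEquiv_symm_fmod (J : Subgroup P) {i j : Idx (P := P) J} (hij : i ≤ j)
    (x : Gmod (φ.codRestrict T hT) (A.subgroupOf T) H J i) :
    (gmodEquiv φ A H T hT hAT J j).symm (fmod (φ.codRestrict T hT) (A.subgroupOf T) H J i j hij x) =
      fmod φ A H J i j hij ((gmodEquiv φ A H T hT hAT J i).symm x) := by
  apply (gmodEquiv φ A H T hT hAT J j).injective
  rw [AddEquiv.apply_symm_apply, gmodEquiv_fmod, AddEquiv.apply_symm_apply]

/-- Restriction of the ambient on the direct limit (forward map). [cite: Mochizuki2012, Prop 1.4 p.27] -/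
def limShrink (J : Subgroup P) : h1Lim φ A H J →+ h1Lim (φ.codRestrict T hT) (A.subgroupOf T) H J :=
  AddCommGroup.DirectLimit.lift (Gmod φ A H J) (fmod φ A H J) _
    (fun i => (h1Of (φ.codRestrict T hT) (A.subgroupOf T) H J i).comp
      (gmodEquiv φ A H T hT hAT J i).toAddMonoidHom)
    (fun i j hij x => by
      change h1Of _ _ H J j (gmodEquiv φ A H T hT hAT J j (fmod φ A H J i j hij x)) =
        h1Of _ _ H J i (gmodEquiv φ A H T hT hAT J i x)
      rw [gmodEquiv_fmod, h1Of_fmod])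

/-- Restriction of the ambient on the direct limit (backward map). [cite: Mochizuki2012, Prop 1.4 p.27] -/
def limUnshrink (J : Subgroup P) : h1Lim (φ.codRestrict T hT) (A.subgroupOf T) H J →+ h1Lim φ A H J :=
  AddCommGroup.DirectLimit.lift (Gmod (φ.codRestrict T hT) (A.subgroupOf T) H J)
    (fmod (φ.codRestrict T hT) (A.subgroupOf T) H J) _
    (fun i => (h1Of φ A H J i).comp (gmodEquiv φ A H T hT hAT J i).symm.toAddMonoidHom)
    (fun i j hij x => by
      change h1Of φ A H J j ((gmodEquiv φ A H T hT hAT J j).symm (fmod _ _ H J i j hij x)) =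
        h1Of φ A H J i ((gmodEquiv φ A H T hT hAT J i).symm x)
      rw [gmodEquiv_symm_fmod, h1Of_fmod])

/-- `limShrink` on generators. [cite: Mochizuki2012, Prop 1.4 p.27] -/
@[simp] theorem limShrink_of (J : Subgroup P) (i : Idx (P := P) J) (x : Gmod φ A H J i) :
    limShrink φ A H T hT hAT J (h1Of φ A H J i x) =
      h1Of (φ.codRestrict T hT) (A.subgroupOf T) H J i (gmodEquiv φ A H T hT hAT J i x) :=
  AddCommGroup.DirectLimit.lift_of (G := Gmod φ A H J) (f := fmod φ A H J) _ _ _ i x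

/-- `limUnshrink` on generators. [cite: Mochizuki2012, Prop 1.4 p.27] -/
@[simp] theorem limUnshrink_of (J : Subgroup P) (i : Idx (P := P) J)
    (x : Gmod (φ.codRestrict T hT) (A.subgroupOf T) H J i) :
    limUnshrink φ A H T hT hAT J (h1Of (φ.codRestrict T hT) (A.subgroupOf T) H J i x) =
      h1Of φ A H J i ((gmodEquiv φ A H T hT hAT J i).symm x) :=
  AddCommGroup.DirectLimit.lift_of (G := Gmod (φ.codRestrict T hT) (A.subgroupOf T) H J)
    (f := fmod (φ.codRestrict T hT) (A.subgroupOf T) H J) _ _ _ i x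

/-- `limUnshrink ∘ limShrink = id`. [cite: Mochizuki2012, Prop 1.4 p.27] -/
theorem limUnshrink_comp_limShrink (J : Subgroup P) :
    (limUnshrink φ A H T hT hAT J).comp (limShrink φ A H T hT hAT J) = AddMonoidHom.id _ :=
  h1Lim_hom_ext φ A H fun i x => by
    rw [AddMonoidHom.comp_apply, limShrink_of, limUnshrink_of, AddEquiv.symm_apply_apply, AddMonoidHom.id_apply]

/-- `limShrink ∘ limUnshrink = id`. [cite: Mochizuki2012, Prop 1.4 p.27] -/
theorem limShrink_comp_limUnshrink (J : Subgroup P) :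
    (limShrink φ A H T hT hAT J).comp (limUnshrink φ A H T hT hAT J) = AddMonoidHom.id _ :=
  h1Lim_hom_ext (φ.codRestrict T hT) (A.subgroupOf T) H fun i x => by
    rw [AddMonoidHom.comp_apply, limUnshrink_of, limShrink_of, AddEquiv.apply_symm_apply, AddMonoidHom.id_apply]

/-- **`lim_K H¹(H|_K, A) ≅ lim_K H¹(H|_K, A.subgroupOf T)`**: the direct limit does not see the part of the
ambient outside `T`. [cite: Mochizuki2012, Prop 1.4 p.27] -/
def limEquiv (J : Subgroup P) : h1Lim φ A H J ≃+ h1Lim (φ.codRestrict T hT) (A.subgroupOf T) H J where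
  toFun := limShrink φ A H T hT hAT J
  invFun := limUnshrink φ A H T hT hAT J
  left_inv x := DFunLike.congr_fun (limUnshrink_comp_limShrink φ A H T hT hAT J) x
  right_inv x := DFunLike.congr_fun (limShrink_comp_limUnshrink φ A H T hT hAT J) x
  map_add' := map_add _

/-- `limEquiv` on generators. [cite: Mochizuki2012, Prop 1.4 p.27] -/
@[simp] theorem limEquiv_of (J : Subgroup P) (i : Idx (P := P) J) (x : Gmod φ A H J i) :
    limEquiv φ A H T hT hAT J (h1Of φ A H J i x) =
      h1Of (φ.codRestrict T hT) (A.subgroupOf T) H J i (gmodEquiv φ A H T hT hAT J i x) :=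
  limShrink_of φ A H T hT hAT J i x

/-- `limEquiv.symm` on generators. [cite: Mochizuki2012, Prop 1.4 p.27] -/
@[simp] theorem limEquiv_symm_of (J : Subgroup P) (i : Idx (P := P) J)
    (x : Gmod (φ.codRestrict T hT) (A.subgroupOf T) H J i) :
    (limEquiv φ A H T hT hAT J).symm (h1Of (φ.codRestrict T hT) (A.subgroupOf T) H J i x) =
      h1Of φ A H J i ((gmodEquiv φ A H T hT hAT J i).symm x) :=
  limUnshrink_of φ A H T hT hAT J i x

/-- NATURALITY in the system's restriction maps `H1 J → H1 J'`. [cite: Mochizuki2012, Prop 1.4 p.27] -/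
theorem limEquiv_h1Res {J J' : Subgroup P} (h : J' ≤ J) (x : h1Lim φ A H J) :
    limEquiv φ A H T hT hAT J' (h1Res φ A H h x) =
      h1Res (φ.codRestrict T hT) (A.subgroupOf T) H h (limEquiv φ A H T hT hAT J x) := by
  have key : ((limEquiv φ A H T hT hAT J').toAddMonoidHom.comp (h1Res φ A H h)) =
      (h1Res (φ.codRestrict T hT) (A.subgroupOf T) H h).comp (limEquiv φ A H T hT hAT J).toAddMonoidHom :=
    h1Lim_hom_ext φ A H fun i y => by
      change limEquiv φ A H T hT hAT J' (h1Res φ A H h (h1Of φ A H J i y)) =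
        h1Res _ _ H h (limEquiv φ A H T hT hAT J (h1Of φ A H J i y))
      rw [h1Res_of, limEquiv_of, limEquiv_of, h1Res_of]
      rfl
  exact DFunLike.congr_fun key x

/-- NATURALITY in `toLim`: `limEquiv ⊥ ∘ toLim J = toLim J ∘ limEquiv J`. [cite: Mochizuki2012, Prop 1.4 p.27] -/
theorem limEquiv_toLim (J : Subgroup P) (x : h1Lim φ A H J) :
    limEquiv φ A H T hT hAT ⊥ ((cohomologySystemOfContH1 φ A H).toLim J x) =
      (cohomologySystemOfContH1 (φ.codRestrict T hT) (A.subgroupOf T) H).toLim J (limEquiv φ A H T hT hAT J x) :=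
  limEquiv_h1Res φ A H T hT hAT bot_le x

/-- NATURALITY in abc-iut-w4-d043's conjugation action on the limit (`H` normal):
`limEquiv ∘ h1LimConj σ = h1LimConj σ ∘ limEquiv`. [cite: Mochizuki2012, Cor 1.12 (i) p.56] -/
theorem limEquiv_h1LimConj [H.Normal] (σ : P) (x : h1Lim φ A H ⊥) :
    limEquiv φ A H T hT hAT ⊥ (h1LimConj φ A H σ x) =
      h1LimConj (φ.codRestrict T hT) (A.subgroupOf T) H σ (limEquiv φ A H T hT hAT ⊥ x) := by
  have key : ((limEquiv φ A H T hT hAT ⊥).toAddMonoidHom.comp (h1LimConj φ A H σ)) =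
      (h1LimConj (φ.codRestrict T hT) (A.subgroupOf T) H σ).comp (limEquiv φ A H T hT hAT ⊥).toAddMonoidHom :=
    h1Lim_hom_ext φ A H fun i y => by
      change limEquiv φ A H T hT hAT ⊥ (h1LimConj φ A H σ (h1Of φ A H ⊥ i y)) =
        h1LimConj _ _ H σ (limEquiv φ A H T hT hAT ⊥ (h1Of φ A H ⊥ i y))
      rw [h1LimConj_of, limEquiv_of, h1LimConj_of, conjAt_apply, conjAt_apply, limEquiv_of, ← gmodEquiv_fmod]
      congr 1
      exact congrArg Additive.ofMul (h1Equiv_conj φ A T hT hAT (H ⊓ i.core.K) σ _)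
  exact DFunLike.congr_fun key x

/-- NATURALITY in abc-iut-L6-t1's limit transport: for companions `β` on `G'`, `βT` on `T` agreeing on `T`,
`limEquiv ∘ h1LimAut (α, β) = h1LimAut (α, βT) ∘ limEquiv`. [cite: Mochizuki2012, Cor 1.12 (i) p.57] -/
theorem limEquiv_h1LimAut (α : P ≃ₜ* P) (β : G' ≃ₜ* G') (βT : T ≃ₜ* T)
    (hββ : ∀ t : T, ((βT t : T) : G') = β t)
    (hφ : ∀ g, β (φ g) = φ (α g)) (hφT : ∀ g, βT (φ.codRestrict T hT g) = φ.codRestrict T hT (α g))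
    (hA : ∀ a : G', a ∈ A → β a ∈ A) (hA' : ∀ a : T, a ∈ A.subgroupOf T → βT a ∈ A.subgroupOf T)
    (hH : ∀ x, x ∈ H ↔ α x ∈ H) (z : h1Lim φ A H ⊥) :
    limEquiv φ A H T hT hAT ⊥ (h1LimAut φ A H α β hφ hA hH z) =
      h1LimAut (φ.codRestrict T hT) (A.subgroupOf T) H α βT hφT hA' hH (limEquiv φ A H T hT hAT ⊥ z) := by
  have key : ((limEquiv φ A H T hT hAT ⊥).toAddMonoidHom.comp (h1LimAut φ A H α β hφ hA hH)) =
      (h1LimAut (φ.codRestrict T hT) (A.subgroupOf T) H α βT hφT hA' hH).comp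
        (limEquiv φ A H T hT hAT ⊥).toAddMonoidHom :=
    h1Lim_hom_ext φ A H fun i y => by
      change limEquiv φ A H T hT hAT ⊥ (h1LimAut φ A H α β hφ hA hH (h1Of φ A H ⊥ i y)) =
        h1LimAut _ _ H α βT hφT hA' hH (limEquiv φ A H T hT hAT ⊥ (h1Of φ A H ⊥ i y))
      rw [h1LimAut_of, limEquiv_of, limEquiv_of, h1LimAut_of]
      congr 1
      exact congrArg Additive.ofMul
        (h1Equiv_autMap φ A T hT hAT α β βT hββ hφ hφT hA hA' (symm_mem_inf H α hH i.K) (Additive.toMul y))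
  exact DFunLike.congr_fun key z

end Limit

end ContH1Restrict

end

end Literature.IUT.HodgeArakelov
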